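import Literature.NumberTheory.EllipticCurves.BSDQuadraticDescentPeriodEliminationProofs
import Literature.NumberTheory.EllipticCurves.BSDInvariantsProofs
import HarnessLib

/-!
# The imaginary period `Ω⁻` of a Weierstrass curve over `ℝ` and over `ℚ`, and Pal's formula for the
# real period of a quadratic twist by `d < 0` (proved)

Topic `NumberTheory/EllipticCurves`; deliberate dot-notation extensions of Mathlib's
`WeierstrassCurve` namespace, as in `RealPeriod.lean` / `BSDInvariants.lean`. Definitions + theorems
only (no named fact, D-0026).

For an elliptic curve `W` over `ℝ` with period lattice `Λ` (a real lattice: `Λ̄ = Λ`), complex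
conjugation acts on `H₁(E(ℂ), ℤ) = Λ`, and V. Pal (*Periods of quadratic twists of elliptic curves*,
Proc. AMS 140 (2012), p. 1514) defines **`Ω⁻(E) := ∫_{γ⁻} ω`, `γ⁻` a generator of `H₁(E, ℤ)⁻`**, the
subgroup of cycles negated by complex conjugation — i.e. `Ω⁻(E)` is a generator of
`Λ⁻ = {λ ∈ Λ : λ̄ = −λ} = Λ ∩ iℝ`, a purely imaginary number defined up to sign (Pal, §4:
"`σ(Ω⁻(E)) = −Ω⁻(E)`"). We define the POSITIVE real number

* `WeierstrassCurve.imaginaryPeriod W = |Ω⁻(W)| = min {t > 0 : it ∈ Λ}` — the least positive real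
  period of the rotated lattice `iΛ` (`PeriodPair.minRealPeriod (Λ.mulLeft I)`, the `Ω₀'` of
  `RealLatticeCovolumeProofs` / `BSDQuadraticDescentArchimedeanProofs`), for the period lattice of
  THE GIVEN MODEL (`g₂ = c₄/12`, `g₃ = c₆/216`, `exists_periodPair_realPeriod_eq_holds`; independent
  of the chosen period pair, `imaginaryPeriod_eq`); junk `0` for a singular model. Like
  `realPeriod`, it is Pal's `Ω⁻(E)` (in absolute value) when the model is (globally) minimal.
* `WeierstrassCurve.imaginaryPeriodRat W = imaginaryPeriod (W ⊗ ℝ)` for `W` over `ℚ` (twin of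
  `realPeriodRat`).

and prove

* `imaginaryPeriod_eq`, `imaginaryPeriod_eq_sInf` (`= min {t > 0 : it ∈ Λ}` for ANY period pair of
  `W`), `imaginaryPeriod_pos`, `I_mul_imaginaryPeriod_mem` (`i|Ω⁻| ∈ Λ`: it is a period);
* **Pal 2012, Thm. 3.2, case `d < 0`, for the twisted MODEL over `ℝ` (PROVED)**
  `realPeriod_quadraticTwist_mul_sqrt_of_neg`:
  `Ω(W^{(D)}) · √(−D) = c_∞(W^{(D)}) · |Ω⁻(W)|` for `D < 0`, where `W^{(D)} = W.quadraticTwist D`,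
  `Ω = realPeriod = ∫_{E(ℝ)}|ω|` (all real components) and `c_∞ = numRealComponents`
  (`= numRealComponents W`, `numRealComponents_quadraticTwist`) — the period lattice of `W^{(D)}` is
  `(i/√(−D))Λ` (this is the computation inside
  `realPeriod_mul_realPeriod_quadraticTwist_mul_sqrt` of `BSDQuadraticDescentArchimedeanProofs`,
  now stated with a NAME for `Ω₀'`);
* **Pal 2012, Thm. 3.2, case `d < 0`, over `ℚ` (PROVED)** `realPeriodRat_mul_sqrt_of_twist_of_neg`:
  for `W/ℚ`, `d < 0` and ANY model `Wd = C • W^{(d)}` of the twist (e.g. a globally minimal one):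
  `Ω(Wd) · √(−d) = |u(C)| · c_∞(Wd) · |Ω⁻(W)|` — Pal's "`Ω(E^d) = (ũ/√d) c_∞(E^d) Ω⁻(E)` up to
  sign" with his rational factor `ũ` made explicit as `|u|` of the change of variables from the
  model `W^{(d)}` (`c₄ ↦ d²c₄`, `c₆ ↦ d³c₆`) to `Wd` (Pal computes `ũ` for `W`, `Wd` minimal in his
  Prop. 2.5 / Cor. 2.6; that local computation is not repeated here);
* `realPeriod_mul_imaginaryPeriod` (Legendre/area relation, Cremona §3.7):
  `Ω(W) · |Ω⁻(W)| = ∫_{E(ℂ)} |ω ∧ ω̄| = complexPeriod (W ⊗ ℂ)` (`= 2 covol(Λ)`).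

Motivation: BSD rank-`≤ 1` residual cell `b2b-bsdres`, sub-cell additive-p4 (V9 line, twist by
`p* = −p` for `p ≡ 3 (mod 4)`): requested in HOME/INBOX 2026-08-20T00:56Z item (4) together with
the minus modular symbol (`PAdicLFunctionMinus.lean`); companion of additive-p4's
`Pal2012/QuadraticTwistPeriod.lean` (the case `d > 0`).

## References
* V. Pal, *Periods of quadratic twists of elliptic curves*, Proc. Amer. Math. Soc. 140 (2012)
  1513–1525 (= arXiv:1012.0094): p. 1514 (definition of `Ω⁻`), Thm. 3.2 (p. 1518 of the journal,
  arXiv p. 6), §4 Example (purely imaginary). [Pal2012]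
* J. E. Cremona, *Algorithms for modular elliptic curves*, 2nd ed. (1997), §3.7 (period lattice,
  `Δ > 0` rectangular / `Δ < 0`), §2.8. [CremonaAlgorithms1997]
* J. H. Silverman, *The Arithmetic of Elliptic Curves*, 2nd ed. (2009), VI.5.1, C.16. [SilvermanAEC2009]
-/

noncomputable section

open scoped Classical
open Complex

namespace WeierstrassCurve

/-! ## Over `ℝ` -/

section Real

variable (W : WeierstrassCurve ℝ)

/-- The **imaginary period** `|Ω⁻(W)| = min {t > 0 : it ∈ Λ_W}` of a Weierstrass model over `ℝ`:
the least positive real period of the rotated period lattice `iΛ_W`, where `Λ_W` is the period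
lattice of the given model (`g₂(Λ_W) = c₄/12`, `g₃(Λ_W) = c₆/216`,
`exists_periodPair_realPeriod_eq_holds`); equivalently the absolute value of Pal's
`Ω⁻(E) = ∫_{γ⁻} ω`, `γ⁻` a generator of `H₁(E(ℂ), ℤ)⁻ = Λ_W ∩ iℝ` (Pal 2012, p. 1514; for the
minimal model). Junk value `0` for a singular model. Independent of the chosen period pair
(`imaginaryPeriod_eq`). [cite: Pal2012, p. 1514 (definition of Ω⁻)] -/
def imaginaryPeriod : ℝ :=
  if h : W.IsElliptic then
    ((Classical.choose (@exists_periodPair_realPeriod_eq_holds W h)).mulLeft I I_ne_zero).minRealPeriod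
  else 0

variable [W.IsElliptic]

omit [W.IsElliptic] in
/-- Homothetic images of equal lattices are equal: `Λ = Λ' ⇒ cΛ = cΛ'`. [cite: SilvermanAEC2009, proof of Cor. VI.5.1.1] -/
theorem _root_.PeriodPair.mulLeft_lattice_eq_of_lattice_eq {L L' : PeriodPair} {c : ℂ} (hc : c ≠ 0)
    (h : L.lattice = L'.lattice) : (L.mulLeft c hc).lattice = (L'.mulLeft c hc).lattice := by
  ext x
  rw [PeriodPair.mem_mulLeft_lattice, PeriodPair.mem_mulLeft_lattice, h]

/-- **`|Ω⁻(W)|` is the least positive real period of `iΛ` for ANY period pair `Λ` of `W`** (the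
lattice with `g₂ = c₄/12`, `g₃ = c₆/216` is unique, `PeriodPair.uniformization_unique_holds`).
[cite: Pal2012, p. 1514] [cite: SilvermanAEC2009, Thm. VI.5.1] -/
theorem imaginaryPeriod_eq {L : PeriodPair}
    (h₂ : L.g₂ = ((W.c₄ / 12 : ℝ) : ℂ)) (h₃ : L.g₃ = ((W.c₆ / 216 : ℝ) : ℂ)) :
    W.imaginaryPeriod = (L.mulLeft I I_ne_zero).minRealPeriod := by
  rw [imaginaryPeriod, dif_pos ‹W.IsElliptic›]
  obtain ⟨h₁₂, h₁₃, -⟩ := Classical.choose_spec (@exists_periodPair_realPeriod_eq_holds W ‹_›)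
  exact PeriodPair.minRealPeriod_eq_of_lattice_eq (PeriodPair.mulLeft_lattice_eq_of_lattice_eq _
    (PeriodPair.uniformization_unique_holds _ _ (h₁₂.trans h₂.symm) (h₁₃.trans h₃.symm)))

/-- **`|Ω⁻(W)| = inf {t > 0 : i t ∈ Λ}`** for any period pair `Λ` of `W` — Pal's definition read in
absolute value: `Λ ∩ iℝ = ℤ · i|Ω⁻|` (`x ∈ iΛ ↔ −ix ∈ Λ ↔ ix ∈ Λ`).
[cite: Pal2012, p. 1514 (Ω⁻ = ∫_{γ⁻} ω, γ⁻ a generator of H₁(E,ℤ)⁻)] -/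
theorem imaginaryPeriod_eq_sInf {L : PeriodPair}
    (h₂ : L.g₂ = ((W.c₄ / 12 : ℝ) : ℂ)) (h₃ : L.g₃ = ((W.c₆ / 216 : ℝ) : ℂ)) :
    W.imaginaryPeriod = sInf {t : ℝ | 0 < t ∧ I * (t : ℂ) ∈ L.lattice} := by
  rw [W.imaginaryPeriod_eq h₂ h₃, PeriodPair.minRealPeriod_def]
  congr 1
  ext t
  simp only [Set.mem_setOf_eq, PeriodPair.mem_mulLeft_lattice, Complex.inv_I, neg_mul]
  rw [neg_mem_iff]

/-- `|Ω⁻(W)| > 0` for an elliptic curve over `ℝ` (the rotated lattice `iΛ` of a real lattice is real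
and has a positive least real period). [cite: Pal2012, p. 1514] [cite: CremonaAlgorithms1997, §3.7] -/
theorem imaginaryPeriod_pos : 0 < W.imaginaryPeriod := by
  obtain ⟨L, h₂, h₃, -⟩ := W.exists_periodPair_realPeriod_eq_holds
  rw [W.imaginaryPeriod_eq h₂ h₃]
  exact (W.isReal_of_g₂_eq_of_g₃_eq h₂ h₃).mulLeft_I.minRealPeriod_pos

/-- **`i · |Ω⁻(W)| ∈ Λ`**: the imaginary period is (up to the unit `i`) a genuine period of `W` —
a generator of `Λ ∩ iℝ = H₁(E(ℂ), ℤ)⁻`. [cite: Pal2012, p. 1514 and §4 ("it will be a pure imaginary number")] -/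
theorem I_mul_imaginaryPeriod_mem {L : PeriodPair}
    (h₂ : L.g₂ = ((W.c₄ / 12 : ℝ) : ℂ)) (h₃ : L.g₃ = ((W.c₆ / 216 : ℝ) : ℂ)) :
    I * (W.imaginaryPeriod : ℂ) ∈ L.lattice := by
  rw [W.imaginaryPeriod_eq h₂ h₃]
  have h := (W.isReal_of_g₂_eq_of_g₃_eq h₂ h₃).mulLeft_I.minRealPeriod_mem_lattice
  rw [PeriodPair.mem_mulLeft_lattice, Complex.inv_I, neg_mul, neg_mem_iff] at h
  exact h

/-- **Pal 2012, Thm. 3.2, case `d < 0`, for the twisted model over `ℝ` (PROVED).** For an elliptic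
curve `W` over `ℝ` and `D < 0`: `Ω(W^{(D)}) · √(−D) = c_∞(W^{(D)}) · |Ω⁻(W)|`, where
`W^{(D)} = W.quadraticTwist D` (`c₄ ↦ D²c₄`, `c₆ ↦ D³c₆`), `Ω = realPeriod = ∫_{E(ℝ)}|ω|` and
`c_∞ = numRealComponents` — Pal's "if `d < 0`, then `Ω(E^d) = (ũ/√d) c_∞(E^d) Ω⁻(E)`" for the
model `W^{(D)}` itself (`ũ = 1`; the passage to a minimal model of the twist is
`realPeriodRat_mul_sqrt_of_twist_of_neg`). Proof: the period lattice of `W^{(D)}` is `(1/√(−D))·iΛ`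
(`g₂(cΛ) = c⁻⁴g₂`, `g₃(cΛ) = c⁻⁶g₃` with `c² = −1/(−D)`, `quadraticTwist_c₄/c₆`), whose least real
period is `|Ω⁻(W)|/√(−D)`, and `Ω = c_∞ · Ω₀` (`realPeriod_eq_numRealComponents_mul_minRealPeriod`).
[cite: Pal2012, Thm. 3.2 (case d < 0)] [cite: CremonaAlgorithms1997, §3.7] -/
theorem realPeriod_quadraticTwist_mul_sqrt_of_neg {D : ℝ} (hD : D < 0) :
    (W.quadraticTwist D).realPeriod * Real.sqrt (-D) =
      (W.quadraticTwist D).numRealComponents * W.imaginaryPeriod := by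
  have hD0 : D ≠ 0 := hD.ne
  have hnegD : 0 < -D := neg_pos.mpr hD
  haveI : (W.quadraticTwist D).IsElliptic := W.isElliptic_quadraticTwist hD0
  obtain ⟨L, h₂, h₃, -⟩ := W.exists_periodPair_realPeriod_eq_holds
  -- the period lattice of the twist: `(1/√(-D)) · iΛ`
  set t : ℝ := (Real.sqrt (-D))⁻¹ with ht
  have hsqrt : 0 < Real.sqrt (-D) := Real.sqrt_pos.mpr hnegD
  have htpos : 0 < t := inv_pos.mpr hsqrt
  have ht2 : t ^ 2 = (-D)⁻¹ := by rw [ht, inv_pow, Real.sq_sqrt hnegD.le]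
  have ht2C : (t : ℂ) ^ 2 = ((-D : ℝ) : ℂ)⁻¹ := by exact_mod_cast ht2
  have ht4 : ((t : ℂ) ^ 4)⁻¹ = (D : ℂ) ^ 2 := by
    rw [show (t : ℂ) ^ 4 = ((t : ℂ) ^ 2) ^ 2 by ring, ht2C, inv_pow, inv_inv]
    push_cast; ring
  have ht6 : ((t : ℂ) ^ 6)⁻¹ = -(D : ℂ) ^ 3 := by
    rw [show (t : ℂ) ^ 6 = ((t : ℂ) ^ 2) ^ 3 by ring, ht2C, inv_pow, inv_inv]
    push_cast; ring
  have htC : (t : ℂ) ≠ 0 := by exact_mod_cast htpos.ne'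
  set LD := (L.mulLeft I I_ne_zero).mulLeft (t : ℂ) htC with hLD
  have hLD₂ : LD.g₂ = (((W.quadraticTwist D).c₄ / 12 : ℝ) : ℂ) := by
    rw [hLD, PeriodPair.g₂_mulLeft, PeriodPair.g₂_mulLeft_I, h₂, ht4, quadraticTwist_c₄]
    push_cast; ring
  have hLD₃ : LD.g₃ = (((W.quadraticTwist D).c₆ / 216 : ℝ) : ℂ) := by
    rw [hLD, PeriodPair.g₃_mulLeft, PeriodPair.g₃_mulLeft_I, h₃, ht6, quadraticTwist_c₆]
    push_cast; ring
  have hΩD : (W.quadraticTwist D).realPeriod =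
      (W.quadraticTwist D).numRealComponents * (t * (L.mulLeft I I_ne_zero).minRealPeriod) := by
    rw [(W.quadraticTwist D).realPeriod_eq_numRealComponents_mul_minRealPeriod hLD₂ hLD₃]
    congr 1
    exact (L.mulLeft I I_ne_zero).minRealPeriod_mulLeft_ofReal htpos
  rw [hΩD, W.imaginaryPeriod_eq h₂ h₃, ht]
  field_simp

/-- Pal 2012, Thm. 3.2 (`d < 0`) over `ℝ` with `c_∞` of the ORIGINAL curve:
`Ω(W^{(D)}) · √(−D) = c_∞(W) · |Ω⁻(W)|` (`c_∞(W^{(D)}) = c_∞(W)` since `Δ(W^{(D)}) = D⁶Δ(W)`).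
[cite: Pal2012, Thm. 3.2 (case d < 0)] -/
theorem realPeriod_quadraticTwist_mul_sqrt_of_neg' {D : ℝ} (hD : D < 0) :
    (W.quadraticTwist D).realPeriod * Real.sqrt (-D) = W.numRealComponents * W.imaginaryPeriod := by
  rw [W.realPeriod_quadraticTwist_mul_sqrt_of_neg hD, W.numRealComponents_quadraticTwist hD.ne]

/-- **`Ω(W) · |Ω⁻(W)| = ∫_{E(ℂ)} |ω ∧ ω̄|`** (`= complexPeriod (W ⊗ ℂ) = 2 covol(Λ)`): the product
of the real period (all components) and the imaginary period is the complex period — the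
archimedean comparison `realPeriod_mul_realPeriod_quadraticTwist_mul_sqrt` at `D = −1` combined
with `realPeriod_quadraticTwist_mul_sqrt_of_neg'` (rectangular lattices: `c_∞ = 2`,
`covol = Ω₀|Ω⁻|`; rhombic: `c_∞ = 1`, `covol = Ω₀|Ω⁻|/2`). Cremona, *Algorithms*, §3.7.
[cite: CremonaAlgorithms1997, §3.7] [cite: Pal2012, p. 1514] -/
theorem realPeriod_mul_imaginaryPeriod :
    W.realPeriod * W.imaginaryPeriod = (W.map (algebraMap ℝ ℂ)).complexPeriod := by
  have hneg : (-1 : ℝ) < 0 := by norm_num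
  have h1 := W.realPeriod_mul_realPeriod_quadraticTwist_mul_sqrt hneg
  have h2 := W.realPeriod_quadraticTwist_mul_sqrt_of_neg' hneg
  have hn : (0 : ℝ) < W.numRealComponents := by exact_mod_cast W.numRealComponents_pos
  rw [mul_assoc, h2] at h1
  -- `h1 : Ω · (n · Ω⁻) = n · complexPeriod`
  have h3 : (W.numRealComponents : ℝ) * (W.realPeriod * W.imaginaryPeriod) =
      W.numRealComponents * (W.map (algebraMap ℝ ℂ)).complexPeriod := by
    rw [← h1]; ring
  exact mul_left_cancel₀ hn.ne' h3

end Real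

/-! ## Over `ℚ` -/

section Rat

variable (W : WeierstrassCurve ℚ)

/-- The **imaginary period** `|Ω⁻(W)|` of a Weierstrass equation over `ℚ`: the imaginary period
(`WeierstrassCurve.imaginaryPeriod`) of its base change to `ℝ` — Pal's `|Ω⁻(E)|` when `W` is a
(globally) minimal model of `E` (twin of `realPeriodRat`). [cite: Pal2012, p. 1514 (definition of Ω⁻, minimal model)] -/
def imaginaryPeriodRat : ℝ :=
  (W.baseChange ℝ).imaginaryPeriod

/-- Unfolding lemma for `imaginaryPeriodRat`. [cite: Pal2012, p. 1514] -/
theorem imaginaryPeriodRat_def : W.imaginaryPeriodRat = (W.baseChange ℝ).imaginaryPeriod := rfl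

/-- Base change to `ℝ` commutes with the quadratic twist (universal formulas in the `bᵢ`); cf.
`WeierstrassCurve.map_quadraticTwist` (file `QuadraticTwistPadicReduction`, not imported here).
[cite: SilvermanAEC2009, X.2 (quadratic twists)] -/
theorem baseChange_real_quadraticTwist (d : ℚ) :
    (W.quadraticTwist d).baseChange ℝ = (W.baseChange ℝ).quadraticTwist (d : ℝ) := by
  have h : ∀ {F L : Type} [Field F] [Field L] (V : WeierstrassCurve F) (f : F →+* L) (e : F),
      (V.quadraticTwist e).map f = (V.map f).quadraticTwist (f e) := by
    intro F L _ _ V f e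
    ext
    · simp
    · simp [map_div₀, map_ofNat]
    · simp
    · simp [map_div₀, map_ofNat]
    · simp [map_div₀, map_ofNat]
  rw [baseChange, h, eq_ratCast]
  rfl

variable [W.IsElliptic]

/-- `|Ω⁻(W)| > 0` for an elliptic curve over `ℚ`. [cite: Pal2012, p. 1514] -/
theorem imaginaryPeriodRat_pos : 0 < W.imaginaryPeriodRat := by
  haveI : (W.baseChange ℝ).IsElliptic := by rw [baseChange]; infer_instance
  exact (W.baseChange ℝ).imaginaryPeriod_pos

/-- **Pal 2012, Thm. 3.2, case `d < 0`, over `ℚ` (PROVED).** "Recall that `E` is a minimal elliptic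
curve and `E^d` is its quadratic twist by `d`. … If `d < 0`, then
`Ω(E^d) = (ũ/√d) · c_∞(E^d) · Ω⁻(E)`, where `c_∞(E^d)` is the number of connected components of
`E^d(ℝ)`" (up to sign), with Pal's rational factor `ũ` made EXPLICIT: for `W/ℚ` elliptic (e.g. a
globally minimal model of `E`), `d < 0`, and ANY model `Wd = C • W^{(d)}` of the twist over `ℚ`
(e.g. a globally minimal model of `E^d`; `W^{(d)} = W.quadraticTwist d`):
`Ω(Wd) · √(−d) = |u(C)| · c_∞(Wd) · |Ω⁻(W)|` with `Ω = realPeriodRat = ∫_{Wd(ℝ)}|ω|`. (Pal's `ũ`,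
`2ũ ∈ ℤ`, is this `|u|` for minimal `W`, `Wd`, computed prime by prime in his Prop. 2.5 / Cor. 2.6 —
e.g. `u₂ = 1` for `d ≡ 1 (mod 4)` and `u_ℓ = 1` at odd `ℓ ∣ d` with
`min(3v_ℓ(c₄), 2v_ℓ(c₆), v_ℓ(Δ)) < 6`; that non-archimedean computation is not repeated here.)
From `realPeriod_quadraticTwist_mul_sqrt_of_neg` and `Ω(C • V) = |u| Ω(V)` (`realPeriodRat_smul_holds`).
[cite: Pal2012, Thm. 3.2 (case d < 0), p. 1514] [cite: SilvermanAEC2009, §III.1 Table 3.1] -/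
theorem realPeriodRat_mul_sqrt_of_twist_of_neg {d : ℚ} (hd : d < 0) (Wd : WeierstrassCurve ℚ)
    (C : VariableChange ℚ) (hC : C • W.quadraticTwist d = Wd) :
    Wd.realPeriodRat * Real.sqrt (-(d : ℝ)) =
      |((C.u : ℚ) : ℝ)| * (Wd.baseChange ℝ).numRealComponents * W.imaginaryPeriodRat := by
  subst hC
  haveI : (W.baseChange ℝ).IsElliptic := by rw [baseChange]; infer_instance
  have hdR : (d : ℝ) < 0 := by exact_mod_cast hd
  -- number of real components: invariant under the change of variables (`Δ ↦ u⁻¹² Δ`)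
  have hn : ((C • W.quadraticTwist d).baseChange ℝ).numRealComponents =
      ((W.baseChange ℝ).quadraticTwist (d : ℝ)).numRealComponents := by
    rw [← W.baseChange_real_quadraticTwist, numRealComponents_baseChange_real,
      numRealComponents_baseChange_real, variableChange_Δ]
    have hu : (0 : ℚ) < C.u⁻¹ ^ 12 := by
      rw [show (12 : ℕ) = 2 * 6 by rfl, pow_mul]
      exact pow_pos (lt_of_le_of_ne (sq_nonneg _) (Ne.symm (pow_ne_zero _ (Units.ne_zero _)))) 6
    simp only [mul_pos_iff_of_pos_left hu]
  rw [(W.quadraticTwist d).realPeriodRat_smul_holds C, realPeriodRat_def,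
    W.baseChange_real_quadraticTwist, hn, imaginaryPeriodRat_def, mul_assoc, mul_assoc,
    ← (W.baseChange ℝ).realPeriod_quadraticTwist_mul_sqrt_of_neg hdR]

/-- Pal 2012, Thm. 3.2 (`d < 0`) over `ℚ` with `c_∞` of `E` instead of `E^d` (equal for `d < 0`:
`Δ(E^d) = u⁻¹² d⁶ Δ(E)` has the sign of `Δ(E)`): `Ω(Wd) · √(−d) = |u(C)| · c_∞(W) · |Ω⁻(W)|`.
[cite: Pal2012, Thm. 3.2 (case d < 0)] -/
theorem realPeriodRat_mul_sqrt_of_twist_of_neg' {d : ℚ} (hd : d < 0) (Wd : WeierstrassCurve ℚ)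
    (C : VariableChange ℚ) (hC : C • W.quadraticTwist d = Wd) :
    Wd.realPeriodRat * Real.sqrt (-(d : ℝ)) =
      |((C.u : ℚ) : ℝ)| * (W.baseChange ℝ).numRealComponents * W.imaginaryPeriodRat := by
  have hn : (Wd.baseChange ℝ).numRealComponents = (W.baseChange ℝ).numRealComponents := by
    subst hC
    rw [numRealComponents_baseChange_real, numRealComponents_baseChange_real, variableChange_Δ,
      quadraticTwist_Δ]
    have hu : (0 : ℚ) < C.u⁻¹ ^ 12 := by
      rw [show (12 : ℕ) = 2 * 6 by rfl, pow_mul]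
      exact pow_pos (lt_of_le_of_ne (sq_nonneg _) (Ne.symm (pow_ne_zero _ (Units.ne_zero _)))) 6
    have hd6 : (0 : ℚ) < d ^ 6 := by
      rw [show (6 : ℕ) = 2 * 3 by rfl, pow_mul]
      exact pow_pos (lt_of_le_of_ne (sq_nonneg _) (Ne.symm (pow_ne_zero _ hd.ne))) 3
    simp only [mul_pos_iff_of_pos_left hu, mul_pos_iff_of_pos_left hd6]
  rw [W.realPeriodRat_mul_sqrt_of_twist_of_neg hd Wd C hC, hn]

/-- **`Ω(W) · |Ω⁻(W)| = ∫_{E(ℂ)}|ω ∧ ω̄|`** over `ℚ` (`realPeriodRat`, `imaginaryPeriodRat`,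
`complexPeriod` of `W ⊗ ℂ`). Cremona, *Algorithms*, §3.7. [cite: CremonaAlgorithms1997, §3.7] -/
theorem realPeriodRat_mul_imaginaryPeriodRat :
    W.realPeriodRat * W.imaginaryPeriodRat = ((W.baseChange ℝ).map (algebraMap ℝ ℂ)).complexPeriod := by
  haveI : (W.baseChange ℝ).IsElliptic := by rw [baseChange]; infer_instance
  rw [realPeriodRat_def, imaginaryPeriodRat_def]
  exact (W.baseChange ℝ).realPeriod_mul_imaginaryPeriod

end Rat

end WeierstrassCurve

end
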